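import Mathlib.LinearAlgebra.Eigenspace.Basic
import Mathlib.LinearAlgebra.Matrix.Nondegenerate
import Mathlib.LinearAlgebra.FiniteDimensional.Lemmas
import Mathlib.Tactic.LinearCombination
import Mathlib.Tactic.FieldSimp
import Mathlib.Tactic.Ring
import HarnessLib

/-!
# Route `PhantomRMYoshida`, support item `PhantomRMTransport` (stmt-Langlands-13641): the two
# eigenplanes of `Φ ⊗ k`

Helpers for the transport lemma `Summit.Langlands.Langlands.Theses.PhantomRMYoshida.PhantomRMTransport`.
Setting (all over a field `k`): a matrix `Φ ∈ M₄(k)` with `Φ² = a Φ + b` and a root `λ` of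
`X² - a X - b` with `λ ≠ λ' := a - λ` (two distinct roots).  Then `k⁴ = W ⊕ W'` for the eigenspaces
`W = ker (Φ - λ)`, `W' = ker (Φ - λ')` (`isCompl_eigenspace`), every matrix commuting with `Φ`
preserves both (`mulVec_mem_eigenspace_of_commute`), and for an alternating form `J` (`Jᵀ = -J`,
`2 ≠ 0`) for which `Φ` is self-adjoint (`Φᵀ J = J Φ`) the two eigenspaces are orthogonal
(`dotProduct_mulVec_eq_zero_of_mem_eigenspace`), every vector is isotropic, and when `det J ≠ 0` a
spanning pair `e₀, e₁` of `W` has `e₀ᵀ J e₁ ≠ 0` (`dotProduct_mulVec_ne_zero_of_span`).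
-/

set_option linter.dupNamespace false
set_option autoImplicit false

namespace Summit.Langlands.Langlands.Theorems.PhantomRMTransport

open Matrix Module

universe u

variable {k : Type u} [Field k]

/-! ### The two roots -/

/-- If `λ` and `λ'` are distinct roots of `X² - aX - b` then `λ + λ' = a`. [folklore] -/
theorem add_eq_of_roots {a b lam lam' : k} (h : lam * lam = a * lam + b)
    (h' : lam' * lam' = a * lam' + b) (hne : lam ≠ lam') : lam + lam' = a := by
  have h1 : (lam - lam') * (lam + lam' - a) = 0 := by linear_combination h - h'
  rcases mul_eq_zero.1 h1 with h2 | h2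
  · exact absurd (sub_eq_zero.1 h2) hne
  · exact sub_eq_zero.1 h2

/-- If `λ` and `λ'` are distinct roots of `X² - aX - b` then `λ λ' = -b`. [folklore] -/
theorem mul_eq_of_roots {a b lam lam' : k} (h : lam * lam = a * lam + b)
    (h' : lam' * lam' = a * lam' + b) (hne : lam ≠ lam') : lam * lam' = -b := by
  have hadd := add_eq_of_roots h h' hne
  linear_combination lam * hadd - h

/-- The roots of `X² - aX - b` are `λ` and `λ'` (given two distinct roots). [folklore] -/
theorem eq_or_eq_of_root {a b lam lam' : k} (h : lam * lam = a * lam + b)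
    (h' : lam' * lam' = a * lam' + b) (hne : lam ≠ lam') {x : k} (hx : x * x = a * x + b) :
    x = lam ∨ x = lam' := by
  have hadd := add_eq_of_roots h h' hne
  have hmul := mul_eq_of_roots h h' hne
  have h1 : (x - lam) * (x - lam') = 0 := by linear_combination hx - x * hadd + hmul
  rcases mul_eq_zero.1 h1 with h2 | h2
  · exact Or.inl (sub_eq_zero.1 h2)
  · exact Or.inr (sub_eq_zero.1 h2)

/-! ### The eigenspace decomposition -/

section Eigen

variable {n : Type*} [Fintype n] [DecidableEq n]

/-- Membership in an eigenspace of `Matrix.toLin' Φ`, in matrix terms. [folklore] -/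
theorem mem_eigenspace_toLin'_iff (Φ : Matrix n n k) (μ : k) (v : n → k) :
    v ∈ End.eigenspace (Matrix.toLin' Φ) μ ↔ Φ *ᵥ v = μ • v := by
  rw [End.mem_eigenspace_iff, Matrix.toLin'_apply]

/-- **`kⁿ = ker(Φ - λ) ⊕ ker(Φ - λ')`** for `Φ² = aΦ + b` and the two distinct roots `λ, λ'` of
`X² - aX - b`. [folklore] -/
theorem isCompl_eigenspace {Φ : Matrix n n k} {a b lam lam' : k} (hΦ : Φ * Φ = a • Φ + b • 1)
    (h : lam * lam = a * lam + b) (h' : lam' * lam' = a * lam' + b) (hne : lam ≠ lam') :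
    IsCompl (End.eigenspace (Matrix.toLin' Φ) lam) (End.eigenspace (Matrix.toLin' Φ) lam') := by
  have hadd := add_eq_of_roots h h' hne
  have hmul := mul_eq_of_roots h h' hne
  have hsub : lam - lam' ≠ 0 := sub_ne_zero.2 hne
  have hΦΦ : ∀ v : n → k, Φ *ᵥ (Φ *ᵥ v) = a • (Φ *ᵥ v) + b • v := fun v => by
    rw [Matrix.mulVec_mulVec, hΦ, Matrix.add_mulVec, Matrix.smul_mulVec, Matrix.smul_mulVec,
      Matrix.one_mulVec]
  refine ⟨?_, ?_⟩
  · rw [Submodule.disjoint_def]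
    intro v hv hv'
    rw [mem_eigenspace_toLin'_iff] at hv hv'
    have h0 : (lam - lam') • v = 0 := by rw [sub_smul, ← hv, ← hv', sub_self]
    exact (smul_eq_zero.1 h0).resolve_left hsub
  · rw [codisjoint_iff, eq_top_iff]
    rintro v -
    -- `v = (λ - λ')⁻¹ (Φ v - λ' v) + (λ' - λ)⁻¹ (Φ v - λ v)`
    have h1 : (lam - lam')⁻¹ • (Φ *ᵥ v - lam' • v) ∈ End.eigenspace (Matrix.toLin' Φ) lam := by
      rw [mem_eigenspace_toLin'_iff, Matrix.mulVec_smul, Matrix.mulVec_sub, Matrix.mulVec_smul, hΦΦ,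
        smul_comm lam]
      congr 1
      ext i
      simp only [Pi.add_apply, Pi.sub_apply, Pi.smul_apply, smul_eq_mul]
      linear_combination (-(Φ *ᵥ v) i) * hadd + (v i) * hmul
    have h2 : (lam' - lam)⁻¹ • (Φ *ᵥ v - lam • v) ∈ End.eigenspace (Matrix.toLin' Φ) lam' := by
      rw [mem_eigenspace_toLin'_iff, Matrix.mulVec_smul, Matrix.mulVec_sub, Matrix.mulVec_smul, hΦΦ,
        smul_comm lam']
      congr 1
      ext i
      simp only [Pi.add_apply, Pi.sub_apply, Pi.smul_apply, smul_eq_mul]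
      linear_combination (-(Φ *ᵥ v) i) * hadd + (v i) * hmul
    have hv : v = (lam - lam')⁻¹ • (Φ *ᵥ v - lam' • v) + (lam' - lam)⁻¹ • (Φ *ᵥ v - lam • v) := by
      have hsub' : lam' - lam ≠ 0 := sub_ne_zero.2 hne.symm
      ext i
      simp only [Pi.add_apply, Pi.sub_apply, Pi.smul_apply, smul_eq_mul]
      field_simp
      ring
    rw [hv]
    exact Submodule.add_mem_sup h1 h2

/-- A matrix commuting with `Φ` maps each eigenspace of `Φ` into itself. [folklore] -/
theorem mulVec_mem_eigenspace_of_commute {Φ B : Matrix n n k} (hB : B * Φ = Φ * B) {μ : k}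
    {v : n → k} (hv : v ∈ End.eigenspace (Matrix.toLin' Φ) μ) :
    B *ᵥ v ∈ End.eigenspace (Matrix.toLin' Φ) μ := by
  rw [mem_eigenspace_toLin'_iff] at hv ⊢
  rw [Matrix.mulVec_mulVec, ← hB, ← Matrix.mulVec_mulVec, hv, Matrix.mulVec_smul]

/-! ### The alternating form -/

/-- **Orthogonality of the two eigenspaces** for a `J`-self-adjoint `Φ` (`Φᵀ J = J Φ`):
`vᵀ J w = 0` for `v ∈ ker(Φ - λ)`, `w ∈ ker(Φ - λ')`, `λ ≠ λ'`. [folklore] -/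
theorem dotProduct_mulVec_eq_zero_of_mem_eigenspace {Φ J : Matrix n n k} (hΦJ : Φᵀ * J = J * Φ)
    {lam lam' : k} (hne : lam ≠ lam') {v w : n → k}
    (hv : v ∈ End.eigenspace (Matrix.toLin' Φ) lam) (hw : w ∈ End.eigenspace (Matrix.toLin' Φ) lam') :
    v ⬝ᵥ (J *ᵥ w) = 0 := by
  rw [mem_eigenspace_toLin'_iff] at hv hw
  have h1 : v ⬝ᵥ (J *ᵥ (Φ *ᵥ w)) = lam' * (v ⬝ᵥ (J *ᵥ w)) := by
    rw [hw, Matrix.mulVec_smul, dotProduct_smul, smul_eq_mul]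
  have h2 : v ⬝ᵥ (J *ᵥ (Φ *ᵥ w)) = lam * (v ⬝ᵥ (J *ᵥ w)) := by
    rw [Matrix.mulVec_mulVec, ← hΦJ, ← Matrix.mulVec_mulVec, Matrix.dotProduct_mulVec,
      Matrix.vecMul_transpose, hv, smul_dotProduct, smul_eq_mul]
  have h3 : (lam - lam') * (v ⬝ᵥ (J *ᵥ w)) = 0 := by rw [sub_mul, ← h1, ← h2, sub_self]
  exact (mul_eq_zero.1 h3).resolve_left (sub_ne_zero.2 hne)

omit [DecidableEq n] in
/-- Every vector is isotropic for an alternating matrix (`Jᵀ = -J`) when `2 ≠ 0`. [folklore] -/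
theorem dotProduct_mulVec_self_eq_zero {J : Matrix n n k} (hJ : Jᵀ = -J) (h2 : (2 : k) ≠ 0)
    (v : n → k) : v ⬝ᵥ (J *ᵥ v) = 0 := by
  have h : v ⬝ᵥ (J *ᵥ v) = -(v ⬝ᵥ (J *ᵥ v)) := by
    conv_lhs => rw [Matrix.dotProduct_mulVec, ← Matrix.mulVec_transpose, hJ, Matrix.neg_mulVec,
      dotProduct_comm, dotProduct_neg]
  have h' : (2 : k) * (v ⬝ᵥ (J *ᵥ v)) = 0 := by linear_combination h
  exact (mul_eq_zero.1 h').resolve_left h2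

omit [DecidableEq n] in
/-- Invariance of the form under a similitude: if `Rᵀ J R = c • J` then
`(R v)ᵀ J (R w) = c · vᵀ J w`. [folklore] -/
theorem dotProduct_mulVec_of_transpose_mul {J R : Matrix n n k} {c : k} (hR : Rᵀ * J * R = c • J)
    (v w : n → k) : (R *ᵥ v) ⬝ᵥ (J *ᵥ (R *ᵥ w)) = c * (v ⬝ᵥ (J *ᵥ w)) := by
  rw [Matrix.mulVec_mulVec, Matrix.dotProduct_mulVec, ← Matrix.vecMul_transpose (R) v,
    Matrix.vecMul_vecMul, ← Matrix.dotProduct_mulVec, ← Matrix.mul_assoc, hR, Matrix.smul_mulVec,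
    dotProduct_smul, smul_eq_mul]

/-- **Non-degeneracy of `J` on an eigenplane.** With `J` alternating (`Jᵀ = -J`, `2 ≠ 0`) and
non-degenerate (`det J ≠ 0`), `Φ` self-adjoint and `λ ≠ λ'` the two roots: if `e₀, e₁` span
`ker(Φ - λ)` then `e₀ᵀ J e₁ ≠ 0` (otherwise `e₀` would be orthogonal to `ker(Φ-λ) ⊕ ker(Φ-λ') = kⁿ`).
[folklore] -/
theorem dotProduct_mulVec_ne_zero_of_span {Φ J : Matrix n n k} {a b lam lam' : k}
    (hΦ : Φ * Φ = a • Φ + b • 1) (h : lam * lam = a * lam + b) (h' : lam' * lam' = a * lam' + b)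
    (hne : lam ≠ lam') (hΦJ : Φᵀ * J = J * Φ) (hJ : Jᵀ = -J) (h2 : (2 : k) ≠ 0) (hJdet : J.det ≠ 0)
    {e₀ e₁ : n → k} (he₀ : e₀ ≠ 0) (he₀W : e₀ ∈ End.eigenspace (Matrix.toLin' Φ) lam)
    (hspan : End.eigenspace (Matrix.toLin' Φ) lam ≤ Submodule.span k {e₀, e₁}) :
    e₀ ⬝ᵥ (J *ᵥ e₁) ≠ 0 := by
  intro h01
  apply he₀
  refine (Matrix.nondegenerate_of_det_ne_zero hJdet).eq_zero_of_ortho fun x => ?_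
  -- decompose `x` along `kⁿ = W ⊕ W'`
  have hc := isCompl_eigenspace hΦ h h' hne
  have hx : x ∈ End.eigenspace (Matrix.toLin' Φ) lam ⊔ End.eigenspace (Matrix.toLin' Φ) lam' := by
    rw [hc.sup_eq_top]; exact Submodule.mem_top
  obtain ⟨w, hw, w', hw', rfl⟩ := Submodule.mem_sup.1 hx
  rw [Matrix.mulVec_add, dotProduct_add, dotProduct_mulVec_eq_zero_of_mem_eigenspace hΦJ hne he₀W hw',
    add_zero]
  -- `w = c₀ e₀ + c₁ e₁`
  obtain ⟨c₀, c₁, rfl⟩ := Submodule.mem_span_pair.1 (hspan hw)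
  rw [Matrix.mulVec_add, Matrix.mulVec_smul, Matrix.mulVec_smul, dotProduct_add, dotProduct_smul,
    dotProduct_smul, dotProduct_mulVec_self_eq_zero hJ h2, h01, smul_zero, smul_zero, add_zero]

end Eigen

end Summit.Langlands.Langlands.Theorems.PhantomRMTransport
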